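import Literature.NumberTheory.Automorphic.TotallyRealModularityLargeImage
import Literature.NumberTheory.Automorphic.CDTTheorem722
import Summits.ABC.ABC.Theorems.DefiniteXiFreyModularityStubAbsIrrNegThreeGroup
import HarnessLib

/-!
# Stub ideation k3 · GEN 8 · `stub_liftThree` (crux `FreyModularity`, stmt-ABC-11340, line `Sketch`)

HOME FAMILY 3 — PROBE THE EXTREMES, techniques (a) MINIMAL COUNTEREXAMPLE / INVERSION (what do the
hypotheses FORCE?) and (d) REFUTED VARIANTS AS DATA — the two family-3 techniques untouched by GEN 2–7.
Companion file: elaboration sanity only; every `sorry` is a PROPOSED HELPER LEMMA (none registered,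
nothing touches `Lines/Sketch.lean`).  GEN 2–7 files (`STUB_IDEAS_stub_liftThree_3*.lean`: E/X/H/T/W/L
labels) stay valid by reference.

The stub (S1b, `Lines/Sketch.lean:157`):
`∀ W ρ, W.IsTorsionGaloisRep 3 ρ → ρ.IsAbsIrreducibleOverSqrt (-3) → ¬ 9 ∣ N_W → ρ.IsModular →
   W.IsModularGaloisRepTate 3`  (Conrad–Diamond–Taylor 1999 Thm. 7.2.1 ∩ {9 ∤ N}).

WHAT GEN 8 ADDS — the IMAGE DICHOTOMY at `ℓ = 3`.  Pushing "suppose `(W, ρ̄)` is a counterexample; what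
do `hρ` + `hirr` force on `G = ρ̄(Γ_ℚ) ≤ GL₂(𝔽₃)` (order 48)?": `det ρ̄ = χ̄₃` is PROVED in the tree
(`WeierstrassCurve.det_eq_modPCyclotomicCharacter_of_isTorsionGaloisRep_holds`, Weil pairing), so
`ρ̄(Γ_{ℚ(√-3)}) = G ∩ SL₂(𝔽₃)` (Freitas–Le Hung–Siksek Prop. 3.1 (i), tree
`range_restrictField_cyclotomic_eq_of_det`, A1); `hirr` makes it non-abelian, hence `⊇ Q₈` (K3/K6:
the non-abelian subgroups of `SL₂(𝔽₃) ≅ Q₈ ⋊ C₃` are `Q₈` and `SL₂(𝔽₃)`), hence (`det` onto `{±1}` via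
complex conjugation) **`G` is the semidihedral 2-Sylow `SD₁₆ = N(C_ns)` or all of `GL₂(𝔽₃)`** (A3), and
**`hirr ⟺ ∃ σ, orderOf (ρ̄ σ) = 8`** (A4 — the converse of the landed certificate
`isAbsIrreducibleOverSqrt_negThree_of_orderOf_eq_eight`; K4).  This is exactly de Shalit's Case 3
(`p = 3`, `k' = 𝔽₃`) of the Taylor–Wiles Chebotarev step [Cornell–Silverman–Stevens p. 523] and the
group theory behind Wiles 1995 p. 544 ("neither reducible nor contained in a Sylow 2-subgroup" = the
`GL₂(𝔽₃)` branch only).  In the `SD₁₆` branch `ρ̄ = Ind_K^ℚ χ̄` for the quadratic `K ≠ ℚ(√-3)` cut out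
by `C₈ ◁ G` (A5/K5), with `3` inert (supersingular) or ramified (multiplicative) in `K` under `h9` —
never split, so Wiles's CM shortcut (Thm. 4.8, `L` unramified at `p`) never applies and BOTH branches go
through Taylor–Wiles: the dichotomy is a census item + a direct TW witness (X7′), not a new core.

Contents: §0 the stub verbatim; §1 kernel-decided facts K3–K6 in `M₂(𝔽₃)` (PROVED, `decide +kernel`);
§2 Galois side A0–A5, X7′ (PROPOSED, `sorry`; sizes in the docstrings).
-/

set_option linter.dupNamespace false

noncomputable section

open scoped MatrixGroups Polynomial
open Polynomial Matrix Field
open Literature.NumberTheory.EllipticCurves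
open Literature.NumberTheory.Automorphic Literature.NumberTheory.Automorphic.BCDT
open Literature.NumberTheory.GaloisRepresentations
open Summit.ABC.ABC.Theorems

namespace Summit.ABC.ABC.Cruxes.FreyModularity.StubIdeas3G8

/-! ## §0. The stub, verbatim (= `StubIdeas3.LiftThree`) -/

/-- The stub `stub_liftThree` of `Lines/Sketch.lean`, verbatim. -/
def LiftThree : Prop :=
  ∀ (W : WeierstrassCurve ℚ) [W.IsElliptic] (ρ : ModPGaloisRep ℚ (ZMod 3) 2),
    W.IsTorsionGaloisRep 3 ρ → ρ.IsAbsIrreducibleOverSqrt (-3) → ¬ 9 ∣ W.conductorNorm ℤ →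
      ρ.IsModular → W.IsModularGaloisRepTate 3

/-! ## §1. Kernel-decided facts in `M₂(𝔽₃)` (all PROVED) -/

/-- `i ∈ Q₈ ⊂ SL₂(𝔽₃)` (as in GEN 4). -/
def qi : Matrix (Fin 2) (Fin 2) (ZMod 3) := !![0, 1; 2, 0]
/-- `j ∈ Q₈ ⊂ SL₂(𝔽₃)`. -/
def qj : Matrix (Fin 2) (Fin 2) (ZMod 3) := !![1, 1; 1, 2]
/-- `k = i j ∈ Q₈ ⊂ SL₂(𝔽₃)`. -/
def qk : Matrix (Fin 2) (Fin 2) (ZMod 3) := !![1, 2; 2, 2]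

/-- Sanity: `i² = j² = k² = -1`, `i j = k = -j i`. -/
theorem quaternion_relations :
    qi * qi = -1 ∧ qj * qj = -1 ∧ qk * qk = -1 ∧ qi * qj = qk ∧ qj * qi = -qk := by
  unfold qi qj qk; decide +kernel

set_option synthInstance.maxHeartbeats 400000 in
set_option synthInstance.maxSize 4096 in
/-- **K3. A quaternion pair inside any non-abelian subgroup of `SL₂(𝔽₃)` containing an element of
order `4`.**  If `x² = -1` and `y ∈ SL₂(𝔽₃)` does not commute with `x`, then either `(x, y)` is already
an anticommuting pair of elements of order `4`, or `(x, z)` is, with the inverse-free word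
`z = y x y²` (`= ± y x y⁻¹`, since `y` then has order `3` or `6`).  With GEN 4's X1 (non-commuting
`A, B ∈ SL₂(𝔽₃)` give an element of square `-1`) this yields: a non-abelian `H ≤ SL₂(𝔽₃)` contains
`Q₈`.  Finite check over the `3⁸` pairs. [folklore] -/
theorem quaternionPair_of_sq_eq_neg_one_of_mul_ne (x y : Matrix (Fin 2) (Fin 2) (ZMod 3))
    (hx : x * x = -1) (hy : y.det = 1) (hxy : x * y ≠ y * x) :
    (y * y = -1 ∧ x * y = -(y * x)) ∨
      ((y * x * y * y) * (y * x * y * y) = -1 ∧ x * (y * x * y * y) = -((y * x * y * y) * x)) := by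
  obtain ⟨a, b, c, d, rfl⟩ : ∃ a b c d : ZMod 3, x = !![a, b; c, d] :=
    ⟨_, _, _, _, Matrix.eta_fin_two x⟩
  obtain ⟨p, q, r, s, rfl⟩ : ∃ p q r s : ZMod 3, y = !![p, q; r, s] :=
    ⟨_, _, _, _, Matrix.eta_fin_two y⟩
  rw [Matrix.det_fin_two_of] at hy
  revert p q r s
  revert a b c d
  decide +kernel

set_option synthInstance.maxHeartbeats 400000 in
set_option synthInstance.maxSize 4096 in
/-- **K6. An anticommuting pair of elements of order `4` exhausts the axes of `Q₈`:** if
`x² = z² = -1` and `x z = -z x` then `{±x, ±z, ±xz} = {±i, ±j, ±k}`; in particular the subgroup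
generated is the whole (unique, normal) Sylow `2`-subgroup `Q₈` of `SL₂(𝔽₃)`. [folklore] -/
theorem quaternion_axes_of_anticommute (x z : Matrix (Fin 2) (Fin 2) (ZMod 3))
    (hx : x * x = -1) (hz : z * z = -1) (hxz : x * z = -(z * x)) :
    ∀ q ∈ [qi, qj, qk], q ∈ [x, -x, z, -z, x * z, -(x * z)] := by
  unfold qi qj qk
  obtain ⟨a, b, c, d, rfl⟩ : ∃ a b c d : ZMod 3, x = !![a, b; c, d] :=
    ⟨_, _, _, _, Matrix.eta_fin_two x⟩
  obtain ⟨p, q, r, s, rfl⟩ : ∃ p q r s : ZMod 3, z = !![p, q; r, s] :=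
    ⟨_, _, _, _, Matrix.eta_fin_two z⟩
  revert p q r s
  revert a b c d
  decide +kernel

/-- **K4. The coset `det = -1` meets every `Q₈`-coset in an element of order `8`.**  For
`h ∈ GL₂(𝔽₃)` with `det h = -1` one of `h, h i, h j, h k` has fourth power `-1` (i.e. order `8`):
`h` is a reflection (trace `0`) or already of order `8`, and `1, i, j, k` span `M₂(𝔽₃)`, so some
`tr (h q) ≠ 0`, `det (h q) = -1`, whence `h q` generates a non-split Cartan.  Used for
`hirr ⇒ ∃ σ, orderOf (ρ̄ σ) = 8` (A4) with `h = ρ̄(c)`, `c` complex conjugation. [folklore] -/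
theorem pow_four_eq_neg_one_mul_quaternion (h : Matrix (Fin 2) (Fin 2) (ZMod 3)) (hd : h.det = -1) :
    h ^ 4 = -1 ∨ (h * qi) ^ 4 = -1 ∨ (h * qj) ^ 4 = -1 ∨ (h * qk) ^ 4 = -1 := by
  unfold qi qj qk
  obtain ⟨a, b, c, d, rfl⟩ : ∃ a b c d : ZMod 3, h = !![a, b; c, d] :=
    ⟨_, _, _, _, Matrix.eta_fin_two h⟩
  rw [Matrix.det_fin_two_of] at hd
  revert a b c d
  decide +kernel

/-- **K5. `N(C₈)/C(C₈)` acts on a non-split Cartan `C₈ = ⟨a⟩` through the Frobenius `a ↦ a³`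
only:** no `h ∈ GL₂(𝔽₃)` conjugates an element `a` of order `8` (`a⁴ = -1`) to `a⁵` or to
`a⁷ = a⁻¹`.  Hence a subgroup of order `16` containing `a` is the SEMIDIHEDRAL group
`⟨a, x | a⁸ = 1, x² = 1, x a x = a³⟩ = N_{GL₂(𝔽₃)}(⟨a⟩)` (not `D₁₆`, `Q₁₆`, `M₁₆`) — the shape used in
A5. [folklore] -/
theorem not_conj_pow_five_or_seven (a h : Matrix (Fin 2) (Fin 2) (ZMod 3)) (ha : a ^ 4 = -1)
    (hh : h.det ≠ 0) : h * a ≠ a ^ 5 * h ∧ h * a ≠ a ^ 7 * h := by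
  obtain ⟨p, q, r, s, rfl⟩ : ∃ p q r s : ZMod 3, a = !![p, q; r, s] :=
    ⟨_, _, _, _, Matrix.eta_fin_two a⟩
  obtain ⟨e, f, g, i, rfl⟩ : ∃ e f g i : ZMod 3, h = !![e, f; g, i] :=
    ⟨_, _, _, _, Matrix.eta_fin_two h⟩
  rw [Matrix.det_fin_two_of] at hh
  revert e f g i
  revert p q r s
  decide +kernel

/-- `orderOf g = 8 ⟺ g⁴ = -1` in `GL₂(𝔽₃)` — (→) is the tree's `det_eq_neg_one_of_pow_eight_eq_one`,
(←) since `g⁸ = 1 ≠ g⁴`. [folklore] -/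
theorem orderOf_eq_eight_of_pow_four_eq_neg_one (g : GL (Fin 2) (ZMod 3)) (h : g ^ 4 = -1) :
    orderOf g = 8 := by
  have hne : (-1 : GL (Fin 2) (ZMod 3)) ≠ 1 := by
    intro h1
    have h2 := congrArg (fun u : GL (Fin 2) (ZMod 3) ↦ ((u : Matrix (Fin 2) (Fin 2) (ZMod 3)) 0 0)) h1
    simp only [Units.val_neg, Units.val_one, Matrix.neg_apply, Matrix.one_apply_eq] at h2
    revert h2
    decide
  have h4 : ¬ g ^ 2 ^ 2 = 1 := by
    rw [show (2 : ℕ) ^ 2 = 4 from rfl, h]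
    exact hne
  have h8 : g ^ 2 ^ (2 + 1) = 1 := by
    rw [show (2 : ℕ) ^ (2 + 1) = 4 * 2 from rfl, pow_mul, h, neg_one_sq]
  have := orderOf_eq_prime_pow h4 h8
  simpa using this

/-! ## §2. Galois side: the image dichotomy (PROPOSED helper lemmas) -/

/-- **A0 (S). The two conventions for `ℚ(√-3) = ℚ(ζ₃)` agree:** a splitting field of `X² + 3`
over `ℚ` is a `3`-rd cyclotomic extension (`ζ₃ = (-1 + √-3)/2`; conversely `√-3 = ζ₃ - ζ₃²`).  Bridges
`ModPGaloisRep.IsAbsIrreducibleOverSqrt (-3)` (quantifies over `IsSplittingField` models) to the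
FLS lemmas (stated for `IsCyclotomicExtension {3}` models). [folklore] -/
theorem isCyclotomicExtension_three_of_isSplittingField (L : Type) [Field L] [Algebra ℚ L]
    [IsSplittingField ℚ L (X ^ 2 - C (-3 : ℚ))] : IsCyclotomicExtension {3} ℚ L := by
  sorry

/-- **A1 (XS given A0). `ρ̄(Γ_{ℚ(√-3)}) = ρ̄(Γ_ℚ) ∩ SL₂(𝔽₃)`** for every model `L` of `ℚ(√-3)` and every
`ρ̄ : Γ_ℚ → GL₂(𝔽₃)` with `det ρ̄ = χ̄₃` (for `ρ̄ = W[3]`: `hdet` is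
`W.det_eq_modPCyclotomicCharacter_of_isTorsionGaloisRep_holds 3 ρ hρ`).  Freitas–Le Hung–Siksek 2015
Prop. 3.1 (i) = tree `range_restrictField_cyclotomic_eq_of_det`, transported by A0.
[cite: FreitasLeHungSiksek2015, Prop. 3.1 (i)] -/
theorem range_restrictField_eq_range_inf_ker_det (ρ : ModPGaloisRep ℚ (ZMod 3) 2)
    (hdet : ∀ σ : absoluteGaloisGroup ℚ,
      Matrix.GeneralLinearGroup.det (ρ σ) = modPCyclotomicCharacterZMod ℚ 3 σ)
    (L : Type) [Field L] [Algebra ℚ L] [IsSplittingField ℚ L (X ^ 2 - C (-3 : ℚ))] :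
    (FramedGaloisRep.restrictField L ρ).toMonoidHom.range =
      ρ.toMonoidHom.range ⊓
        (Matrix.GeneralLinearGroup.det : GL (Fin 2) (ZMod 3) →* (ZMod 3)ˣ).ker := by
  haveI := isCyclotomicExtension_three_of_isSplittingField L
  haveI : NeZero ((3 : ℕ) : ℚ) := ⟨by norm_num⟩
  exact range_restrictField_cyclotomic_eq_of_det ρ hdet L

/-- **A2 (S). Absolutely irreducible ⇒ non-abelian image** (rank `2`): a commuting family in
`GL₂(𝔽₃)` has a common eigenvector over `𝔽̄₃` (Mathlib `Module.End.exists_eigenvector`-type lemmas for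
commuting endomorphisms over an algebraically closed field), i.e. an invariant line after base change to
`AlgebraicClosure (ZMod 3)`, contradicting `FramedRep.IsAbsolutelyIrreducible`. [folklore] -/
theorem exists_mul_ne_of_isAbsIrreducibleOverSqrt (ρ : ModPGaloisRep ℚ (ZMod 3) 2)
    (hirr : ρ.IsAbsIrreducibleOverSqrt (-3))
    (L : Type) [Field L] [Algebra ℚ L] [IsSplittingField ℚ L (X ^ 2 - C (-3 : ℚ))] :
    ∃ σ τ : absoluteGaloisGroup L,
      FramedGaloisRep.restrictField L ρ σ * FramedGaloisRep.restrictField L ρ τ ≠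
        FramedGaloisRep.restrictField L ρ τ * FramedGaloisRep.restrictField L ρ σ := by
  sorry

/-- **A3 (S/M). THE IMAGE DICHOTOMY at `ℓ = 3`.**  If `det ρ̄ = χ̄₃` and `ρ̄|_{ℚ(√-3)}` is absolutely
irreducible then `ρ̄(Γ_ℚ)` has order `16` (then it is a Sylow `2`-subgroup of `GL₂(𝔽₃)`, semidihedral,
the normaliser of a non-split Cartan — A5) or is all of `GL₂(𝔽₃)`.  Route: `H = ρ̄(Γ_L) = G ∩ SL₂`
(A1) is non-abelian (A2), so contains an element of square `-1` (GEN 4 X1) and then a quaternion pair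
(K3), hence `Q₈ ⊆ H` (K6), `8 ∣ #H ∣ 24`, `#H ∈ {8, 24}`; `det` maps `G` onto `{±1}` (complex
conjugation: `exists_isComplexConjugation`, `modNCyclotomicCharacter_of_isComplexConjugation`) with
kernel `H`, so `#G = 2 · #H ∈ {16, 48}` and `48 ⇒ ⊤` (`Subgroup.eq_top_of_card_eq`, `#GL₂(𝔽₃) = 48`).
= de Shalit's Case 3, `k' = 𝔽₃` [Cornell–Silverman–Stevens 1997, p. 523]; Wiles 1995 p. 544.
[cite: CornellSilvermanStevens1997, Ch. XIV (de Shalit) §3.5 Case 3] -/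
theorem card_range_eq_sixteen_or_range_eq_top (ρ : ModPGaloisRep ℚ (ZMod 3) 2)
    (hdet : ∀ σ : absoluteGaloisGroup ℚ,
      Matrix.GeneralLinearGroup.det (ρ σ) = modPCyclotomicCharacterZMod ℚ 3 σ)
    (hirr : ρ.IsAbsIrreducibleOverSqrt (-3)) :
    Nat.card ρ.toMonoidHom.range = 16 ∨ ρ.toMonoidHom.range = ⊤ := by
  sorry

/-- **A4 (S). `hirr ⟺` an element of order `8` in the image** (given `det ρ̄ = χ̄₃`).  (←) is the
landed certificate `isAbsIrreducibleOverSqrt_negThree_of_orderOf_eq_eight` (GEN 3's E7 route, used by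
R3); (→, NEW): `Q₈ ⊆ G` (as in A3) and `h = ρ̄(c)` has `det h = -1`, so K4 gives `q ∈ {1, i, j, k} ⊆ G`
with `(h q)⁴ = -1`, and `h q = ρ̄(c τ_q)` has order `8` (`orderOf_eq_eight_of_pow_four_eq_neg_one`).
Consequence: the E7 Frobenius certificate of GEN 3 is not merely sufficient — under `hρ` it is
EQUIVALENT to CDT's hypothesis, so `stub_switch`'s acceptance test "`∃ q`, `a_q(W′)² ≡ 2 q (mod 3)`"
loses nothing. [cite: ConradDiamondTaylor1999, Thm. 7.1.2 (proof, p. 556)] -/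
theorem isAbsIrreducibleOverSqrt_negThree_iff_exists_orderOf_eq_eight (ρ : ModPGaloisRep ℚ (ZMod 3) 2)
    (hdet : ∀ σ : absoluteGaloisGroup ℚ,
      Matrix.GeneralLinearGroup.det (ρ σ) = modPCyclotomicCharacterZMod ℚ 3 σ) :
    ρ.IsAbsIrreducibleOverSqrt (-3) ↔ ∃ σ : absoluteGaloisGroup ℚ, orderOf (ρ σ) = 8 := by
  refine ⟨fun hirr ↦ ?_, fun ⟨σ, h8⟩ ↦ isAbsIrreducibleOverSqrt_negThree_of_orderOf_eq_eight ρ hdet h8⟩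
  sorry

/-- **A5 (S). The `SD₁₆` branch is INDUCED:** if `#ρ̄(Γ_ℚ) = 16` there is `σ₀` with `ρ̄(σ₀)` of order
`8` whose cyclic group `C₈ = ⟨ρ̄(σ₀)⟩` (a non-split Cartan, `𝔽₉ˣ`) has index `2` in the image and is
normalised with the Frobenius action `a ↦ a³` (K5).  Reading: `K :=` the quadratic field cut out by
`ρ̄⁻¹(C₈)` has `ρ̄|_{Γ_K} ⊗ 𝔽₉ ≅ χ̄ ⊕ χ̄³` for a character `χ̄ : Γ_K → 𝔽₉ˣ` of order `8`, `ρ̄ ≅ Ind_K^ℚ χ̄`;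
`K ≠ ℚ(√-3)` (`C₈ ≠ Q₈ = G ∩ SL₂`); for `ρ̄ = W[3]` with `9 ∤ N_W`: `3` is inert in `K` iff `W` is
supersingular at `3` (`ρ̄(I₃) = C₈`), ramified iff `W` has an ordinary line at `3` — never split, so
Wiles 1995 Thm. 4.8 (CM case, `L` unramified at `p`, `ρ₀` ordinary) is never available and the branch
is a genuine Taylor–Wiles case (dihedral residual modularity by a weight-one theta series replaces
Langlands–Tunnell only on the `stub_modThree` side). [cite: Wiles1995, Thm. 4.8 and p. 544] -/
theorem semidihedral_of_card_range_eq_sixteen (ρ : ModPGaloisRep ℚ (ZMod 3) 2)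
    (hdet : ∀ σ : absoluteGaloisGroup ℚ,
      Matrix.GeneralLinearGroup.det (ρ σ) = modPCyclotomicCharacterZMod ℚ 3 σ)
    (h16 : Nat.card ρ.toMonoidHom.range = 16) :
    ∃ σ₀ : absoluteGaloisGroup ℚ, orderOf (ρ σ₀) = 8 ∧
      ∀ σ : absoluteGaloisGroup ℚ,
        ρ σ ∈ Subgroup.zpowers (ρ σ₀) ∨ ρ σ * ρ σ₀ * (ρ σ)⁻¹ = ρ σ₀ ^ 3 := by
  sorry

/-- **X7′ (XS–S). Direct Taylor–Wiles witness from the order-`8` element** (GEN 4's X7g with `hirr`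
replaced by its A4-equivalent): `τ := (σ₀²)^(3^(n-1))` fixes `μ_{3ⁿ}` (`χ̄₃(σ₀²) = det² = 1`, so `σ₀²`
acts on `μ_{3ⁿ}` through the `3`-group `Gal(ℚ(ζ_{3ⁿ})/ℚ(ζ₃))`; `modNCyclotomicCharacter_spec` at level
`3ⁿ`) and `ρ̄(τ)² = (ρ̄(σ₀)⁴)^(3^(n-1)) = (-1)^odd = -1`.  Feeds GEN 4's X7 (`q ≡ 1 (3ⁿ)`, `3 ∣ a_q(W)`,
via the tree's Chebotarev `exists_isArithFrobAt_mul_inv_mem_not_mem`) uniformly in both branches of A3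
— the uniform form of de Shalit's `V₄`-lift argument. [cite: DarmonDiamondTaylor1995, Thm. 2.49] -/
theorem exists_sq_eq_neg_one_fixing_zeta_of_orderOf_eq_eight (ρ : ModPGaloisRep ℚ (ZMod 3) 2)
    (hdet : ∀ σ : absoluteGaloisGroup ℚ,
      Matrix.GeneralLinearGroup.det (ρ σ) = modPCyclotomicCharacterZMod ℚ 3 σ)
    {σ₀ : absoluteGaloisGroup ℚ} (h8 : orderOf (ρ σ₀) = 8) (n : ℕ) :
    ∃ τ : absoluteGaloisGroup ℚ,
      ((ρ τ : GL (Fin 2) (ZMod 3)) : Matrix (Fin 2) (Fin 2) (ZMod 3)) *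
          ((ρ τ : GL (Fin 2) (ZMod 3)) : Matrix (Fin 2) (Fin 2) (ZMod 3)) = -1 ∧
        ∀ ζ : AlgebraicClosure ℚ, ζ ^ 3 ^ n = 1 → τ • ζ = ζ := by
  sorry

/-- **How the package meets the stub** (statement-level only; PROVED from A4): under the stub's own
hypotheses the order-`8` witness exists, so every TW-prime / adequacy input of the two `R = T` cores at
`ℓ = 3` (k1 G0–G4, k2 bricks A–D, k3 GEN 4 X5/X7) may assume `∃ σ₀, orderOf (ρ̄ σ₀) = 8` instead of
`hirr`. -/
theorem exists_orderOf_eq_eight_of_hyps (W : WeierstrassCurve ℚ) [W.IsElliptic]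
    (ρ : ModPGaloisRep ℚ (ZMod 3) 2) (hρ : W.IsTorsionGaloisRep 3 ρ)
    (hirr : ρ.IsAbsIrreducibleOverSqrt (-3)) :
    ∃ σ : absoluteGaloisGroup ℚ, orderOf (ρ σ) = 8 :=
  (isAbsIrreducibleOverSqrt_negThree_iff_exists_orderOf_eq_eight ρ
    (W.det_eq_modPCyclotomicCharacter_of_isTorsionGaloisRep_holds 3 ρ hρ)).1 hirr

end Summit.ABC.ABC.Cruxes.FreyModularity.StubIdeas3G8

end
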